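import Mathlib
import Literature.NumberTheory.LFunctions.Zhang2022.Section17NuOneStarMajorant
import Literature.NumberTheory.LFunctions.Zhang2022.TypedSection17Identities
import HarnessLib

/-!
# Zhang (2022) §17 p. 98: the inner sum of u025, `Σ_{l=l₁l₂} χ(l₁)τ₂(l₁)ν₁*(l₂)`, EXACTLY —
# `= ν(l) + (χ∗η₂)(l) + (χ∗η₃)(l) + (χ∗μ∗η₂∗η₃)(l)` for `l ≤ D⁴` ("similar to the proof of (17.5)")

Topic `Literature/NumberTheory/LFunctions/Zhang2022` (Landau–Siegel audit tree; verdict-neutral).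
Y. Zhang, *Discrete mean estimates and the Landau–Siegel zero*, arXiv:2211.02515v1 (2022)
[Zhang2022LandauSiegel] — **an unrefereed manuscript under adjudication**; nothing here asserts or
denies its Theorems 1–2. §17 p. 98 (tex L4838–L4844; DAG `Z22:§17.u025`): "In a way similar to the
proof of (17.5), by Lemma 17.1, we find that the right side [of u024] is equal to
`𝔢₁Σ_{l<D⁴} ν(l)²/l + o(1) = 𝔢₁𝔞 + o(1)`." The "similar to (17.5)" computation is the identity
§17.u008 `1∗μ∗χ∗χ∗υ∗1∗1 = ν` run on the coefficients `ν₁* = υ·[≤D⁴] ∗ nN_{β₂} ∗ nN_{β₃}` (§17.u014;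
`υ = μ∗μχ`, `nN_β(n) = n^{−β}g*(T²/n) = 1 + η(n)`). This file carries it out EXACTLY, keeping the
perturbations `η₂, η₃` (whose size `O(α𝓛)` on `[1, D⁴]` is `Phi3Eval.norm_nN_sub_one_le`,
`Section17SummedError`): with `χτ₂ = χ∗χ`, `χ∗μχ = δ` (tree: `toArithmeticFunction_chi_mul_moebiusChi`)
and `μ∗1 = δ` one has `χτ₂∗υ∗1∗1 = ν`, `χτ₂∗υ∗1 = χ`, `χτ₂∗υ = χ∗μ`, hence

* `toAF_mul_mul_apply` — `(f∗g∗h)(m) = Σ_{m=ar}Σ_{a=a₁a₂} f(a₁)g(a₂)h(r)` for sequences;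
* `toAF_ups_eq` — `υ = μ ∗ μχ` as arithmetic functions;
* `nuOneStar_eq_four_terms` — for `m ≤ D⁴` (the truncation `[≤D⁴]` is invisible):
  `ν₁*(m) = (υ∗1∗1)(m) + (υ∗η₂∗1)(m) + (υ∗1∗η₃)(m) + (υ∗η₂∗η₃)(m)`;
* `inner17_u025_eq` — for `l ≤ D⁴`:
  `Σ_{l=l₁l₂} χ(l₁)τ₂(l₁)ν₁*(l₂) = ν(l) + (χ∗η₂)(l) + (χ∗η₃)(l) + (χ∗μ∗η₂∗η₃)(l)`;
* divisor-sum bookkeeping `bounds_of_mem_antidiag`, `toAF_one_eq_zeta`, `sum_sum_tau_two_eq'`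
  (`τ₂∗1∗1 = τ₄`), `card_antidiag_eq_tau_two` (`1∗1 = τ₂`).

The node `Step17_u025` itself is closed in the companion `Section17Step17u025`. Theorems only (no
definitions, no named facts); axioms standard. WHAT THIS IS NOT: any claim about Theorems 1–2 of the
source or about Landau–Siegel zeros; nothing here bears on the cell's verdict on (8.24).

## References

* Y. Zhang, arXiv:2211.02515v1 (2022), §17 p. 98 (u025), p. 96 ((17.5), u008), p. 97 (u014);
  §3 p. 6 (`ν`, `υ`). [cite: Zhang2022LandauSiegel, §17 u025 p.98]
* R. R. Hall, G. Tenenbaum, *Divisors*, CUP 1988, (0.4). [cite: HallTenenbaum1988, (0.4)]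
-/

noncomputable section

open Complex Real Finset ArithmeticFunction
open Literature.NumberTheory.LFunctions.Zhang2022.Skeleton
open Literature.NumberTheory.LFunctions.Zhang2022.Typed.Section17
open Literature.NumberTheory.LFunctions.Zhang2022.MeanSquareMajorant

namespace Literature.NumberTheory.LFunctions.Zhang2022.Phi3Eval

/-! ## §1. Triple Dirichlet products of sequences, evaluated -/

/-- A member `(a, b)` of the divisor antidiagonal of `n` has `a ≠ 0`, `b ≠ 0`, `a ≤ n`, `b ≤ n`
(bookkeeping for the divisor sums of the Euler-product majorant). [cite: HallTenenbaum1988, (0.4)] -/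
theorem bounds_of_mem_antidiag {n : ℕ} {x : ℕ × ℕ} (hx : x ∈ n.divisorsAntidiagonal) :
    x.1 ≠ 0 ∧ x.2 ≠ 0 ∧ x.1 ≤ n ∧ x.2 ≤ n := by
  have h := Nat.mem_divisorsAntidiagonal.1 hx
  have hn : 0 < n := Nat.pos_of_ne_zero h.2
  have h1 : x.1 ≠ 0 := fun e => h.2 (by rw [← h.1, e, zero_mul])
  have h2 : x.2 ≠ 0 := fun e => h.2 (by rw [← h.1, e, mul_zero])
  exact ⟨h1, h2, Nat.le_of_dvd hn ⟨x.2, h.1.symm⟩,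
    Nat.le_of_dvd hn ⟨x.1, by rw [mul_comm]; exact h.1.symm⟩⟩

/-- `(f ∗ g ∗ h)(m) = Σ_{m = a·r} Σ_{a = a₁a₂} f(a₁)g(a₂)h(r)` for sequences turned into arithmetic
functions (all arguments that occur are `≥ 1`). [cite: Zhang2022LandauSiegel, §17 p.97 (u014)] -/
theorem toAF_mul_mul_apply (f g h : ℕ → ℂ) (m : ℕ) :
    (toArithmeticFunction f * toArithmeticFunction g * toArithmeticFunction h) m =
      ∑ x ∈ m.divisorsAntidiagonal, ∑ y ∈ x.1.divisorsAntidiagonal, f y.1 * g y.2 * h x.2 := by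
  rw [mul_apply]
  refine Finset.sum_congr rfl fun x hx => ?_
  obtain ⟨-, hx2, -, -⟩ := bounds_of_mem_antidiag hx
  rw [mul_apply, Finset.sum_mul]
  refine Finset.sum_congr rfl fun y hy => ?_
  obtain ⟨hy1, hy2, -, -⟩ := bounds_of_mem_antidiag hy
  simp [toArithmeticFunction, hy1, hy2, hx2]

/-- The constant sequence `1` is `ζ` as an arithmetic function. [cite: HallTenenbaum1988, (0.4)] -/
theorem toAF_one_eq_zeta :
    toArithmeticFunction (fun _ : ℕ => (1 : ℂ)) = (ArithmeticFunction.zeta : ArithmeticFunction ℂ) := by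
  ext n
  by_cases hn : n = 0
  · subst hn; simp [toArithmeticFunction]
  · simp [toArithmeticFunction, hn, natCoe_apply, zeta_apply_ne hn]

/-- `Σ_{m = a·r} Σ_{a = a₁a₂} τ₂(a₁) = τ₄(m)` (`τ₂ ∗ 1 ∗ 1 = τ₄`). [cite: HallTenenbaum1988, (0.4)] -/
theorem sum_sum_tau_two_eq' (m : ℕ) :
    ∑ x ∈ m.divisorsAntidiagonal, ∑ y ∈ x.1.divisorsAntidiagonal, tau 2 y.1 = tau 4 m := by
  have h3 : ∀ k : ℕ, tau 3 k = ∑ y ∈ k.divisorsAntidiagonal, tau 2 y.1 := fun k => by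
    rw [show (3 : ℕ) = 2 + 1 from rfl, tau_add_apply]
    refine Finset.sum_congr rfl fun y hy => ?_
    obtain ⟨-, hy2, -, -⟩ := bounds_of_mem_antidiag hy
    rw [tau_one_apply hy2, mul_one]
  rw [show (4 : ℕ) = 3 + 1 from rfl, tau_add_apply]
  refine Finset.sum_congr rfl fun x hx => ?_
  obtain ⟨-, hx2, -, -⟩ := bounds_of_mem_antidiag hx
  rw [tau_one_apply hx2, mul_one, h3]

/-- `Σ_{q : l = q₁q₂} 1 = τ₂(l)` (`1 ∗ 1 = τ₂`). [cite: HallTenenbaum1988, (0.4)] -/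
theorem card_antidiag_eq_tau_two (l : ℕ) :
    ∑ _q ∈ l.divisorsAntidiagonal, (1 : ℝ) = tau 2 l := by
  rw [show (2 : ℕ) = 1 + 1 from rfl, tau_add_apply]
  refine Finset.sum_congr rfl fun q hq => ?_
  obtain ⟨hq1, hq2, -, -⟩ := bounds_of_mem_antidiag hq
  rw [tau_one_apply hq1, tau_one_apply hq2, mul_one]

section Expansion

variable (c' : ℝ) {D : ℕ} (χ : DirichletCharacter ℂ D)

/-- `υ`, as an arithmetic function, is `μ ∗ μχ`. [cite: Zhang2022LandauSiegel, §3 p.6] -/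
theorem toAF_ups_eq :
    toArithmeticFunction (ups χ) = (ArithmeticFunction.moebius : ArithmeticFunction ℂ) *
      toArithmeticFunction (fun k : ℕ => (ArithmeticFunction.moebius k : ℂ) * χ (k : ZMod D)) := by
  have h1 : toArithmeticFunction (fun n : ℕ => (ArithmeticFunction.moebius n : ℂ)) =
      (ArithmeticFunction.moebius : ArithmeticFunction ℂ) := by
    ext n
    by_cases hn : n = 0
    · subst hn; simp [toArithmeticFunction]
    · simp [toArithmeticFunction, hn]
  rw [Skeleton.ups, LSeries.convolution, ArithmeticFunction.toArithmeticFunction_eq_self, h1]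

/-- **`ν₁*` below `D⁴` as four triple products**: for `m ≤ D⁴` (where `υ·[≤D⁴] = υ`),
`ν₁*(m) = (υ∗1∗1)(m) + (υ∗η₂∗1)(m) + (υ∗1∗η₃)(m) + (υ∗η₂∗η₃)(m)`, `η_j = nN_{β_j} − 1`.
[cite: Zhang2022LandauSiegel, §17 p.97 (u014)] -/
theorem nuOneStar_eq_four_terms {m : ℕ} (hmD : m ≤ D ^ 4) :
    nuOneStar c' χ m =
      (toArithmeticFunction (ups χ) * toArithmeticFunction (fun _ : ℕ => (1 : ℂ)) *
          toArithmeticFunction (fun _ : ℕ => (1 : ℂ))) m +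
      (toArithmeticFunction (ups χ) * toArithmeticFunction (fun n : ℕ => nN D (beta2 c' D) n - 1) *
          toArithmeticFunction (fun _ : ℕ => (1 : ℂ))) m +
      (toArithmeticFunction (ups χ) * toArithmeticFunction (fun _ : ℕ => (1 : ℂ)) *
          toArithmeticFunction (fun n : ℕ => nN D (beta3 c' D) n - 1)) m +
      (toArithmeticFunction (ups χ) * toArithmeticFunction (fun n : ℕ => nN D (beta2 c' D) n - 1) *
          toArithmeticFunction (fun n : ℕ => nN D (beta3 c' D) n - 1)) m := by
  rw [toAF_mul_mul_apply, toAF_mul_mul_apply, toAF_mul_mul_apply, toAF_mul_mul_apply,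
    ← Finset.sum_add_distrib, ← Finset.sum_add_distrib, ← Finset.sum_add_distrib]
  simp only [nuOneStar, LSeries.convolution_def]
  refine Finset.sum_congr rfl fun x hx => ?_
  obtain ⟨-, -, hx1, -⟩ := bounds_of_mem_antidiag hx
  rw [Finset.sum_mul, ← Finset.sum_add_distrib, ← Finset.sum_add_distrib, ← Finset.sum_add_distrib]
  refine Finset.sum_congr rfl fun y hy => ?_
  obtain ⟨-, -, hy1, -⟩ := bounds_of_mem_antidiag hy
  have htr : trunc (D ^ 4) (ups χ) y.1 = ups χ y.1 := by
    unfold trunc; exact if_pos (hy1.trans (hx1.trans hmD))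
  rw [htr]
  ring

/-- **The inner sum of u025, exactly**: for `1 ≤ l ≤ D⁴`,
`Σ_{l=l₁l₂} χ(l₁)τ₂(l₁)ν₁*(l₂) = ν(l) + (χ∗η₂)(l) + (χ∗η₃)(l) + (χ∗μ∗η₂∗η₃)(l)` — from
`χτ₂ = χ∗χ`, `χ∗μχ = δ` (tree: `toArithmeticFunction_chi_mul_moebiusChi`), `μ∗1 = δ`, so that
`χτ₂∗υ∗1∗1 = ν`, `χτ₂∗υ∗1 = χ`, `χτ₂∗υ = χ∗μ` (the computation "similar to the proof of (17.5)",
§17.u008). [cite: Zhang2022LandauSiegel, §17 u025 p.98] -/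
theorem inner17_u025_eq {l : ℕ} (hlD : l ≤ D ^ 4) :
    ∑ q ∈ l.divisorsAntidiagonal,
        χ (q.1 : ZMod D) * (q.1.divisors.card : ℂ) * nuOneStar c' χ q.2 =
      nu χ l +
      (toArithmeticFunction (fun k : ℕ => χ (k : ZMod D)) *
          toArithmeticFunction (fun n : ℕ => nN D (beta2 c' D) n - 1)) l +
      (toArithmeticFunction (fun k : ℕ => χ (k : ZMod D)) *
          toArithmeticFunction (fun n : ℕ => nN D (beta3 c' D) n - 1)) l +
      (toArithmeticFunction (fun k : ℕ => χ (k : ZMod D)) *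
          (ArithmeticFunction.moebius : ArithmeticFunction ℂ) *
          toArithmeticFunction (fun n : ℕ => nN D (beta2 c' D) n - 1) *
          toArithmeticFunction (fun n : ℕ => nN D (beta3 c' D) n - 1)) l := by
  -- names
  set Xc : ArithmeticFunction ℂ := toArithmeticFunction (fun k : ℕ => χ (k : ZMod D)) with hXc
  set Mf : ArithmeticFunction ℂ :=
    toArithmeticFunction (fun k : ℕ => (ArithmeticFunction.moebius k : ℂ) * χ (k : ZMod D)) with hMf
  set μC : ArithmeticFunction ℂ := (ArithmeticFunction.moebius : ArithmeticFunction ℂ) with hμC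
  set Z : ArithmeticFunction ℂ := (ArithmeticFunction.zeta : ArithmeticFunction ℂ) with hZ
  set E₂ : ArithmeticFunction ℂ := toArithmeticFunction (fun n : ℕ => nN D (beta2 c' D) n - 1) with hE₂
  set E₃ : ArithmeticFunction ℂ := toArithmeticFunction (fun n : ℕ => nN D (beta3 c' D) n - 1) with hE₃
  have hXM : Xc * Mf = 1 := toArithmeticFunction_chi_mul_moebiusChi χ
  have hμZ : μC * Z = 1 := ArithmeticFunction.coe_moebius_mul_coe_zeta
  have hU : toArithmeticFunction (ups χ) = μC * Mf := toAF_ups_eq χ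
  have h1 : toArithmeticFunction (fun _ : ℕ => (1 : ℂ)) = Z := toAF_one_eq_zeta
  -- `(χ∗χ)(n) = χ(n)τ₂(n)` for `n ≥ 1`
  have hXX : ∀ n : ℕ, n ≠ 0 → (Xc * Xc) n = χ (n : ZMod D) * (n.divisors.card : ℂ) := by
    intro n hn
    rw [mul_apply]
    have key : ∀ q ∈ n.divisorsAntidiagonal, Xc q.1 * Xc q.2 = χ (n : ZMod D) := by
      intro q hq
      obtain ⟨hq1, hq2, -, -⟩ := bounds_of_mem_antidiag hq
      have hqn := (Nat.mem_divisorsAntidiagonal.1 hq).1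
      simp only [hXc, toArithmeticFunction, ArithmeticFunction.coe_mk, hq1, hq2, if_false]
      rw [← map_mul, ← Nat.cast_mul, hqn]
    rw [Finset.sum_congr rfl key, Finset.sum_const, nsmul_eq_mul, mul_comm,
      ← Nat.map_div_right_divisors, Finset.card_map]
  -- the left side as `((χ∗χ) ∗ [four terms])(l)`
  have hL : ∑ q ∈ l.divisorsAntidiagonal,
      χ (q.1 : ZMod D) * (q.1.divisors.card : ℂ) * nuOneStar c' χ q.2 =
      (Xc * Xc * (μC * Mf * Z * Z) + Xc * Xc * (μC * Mf * E₂ * Z) + Xc * Xc * (μC * Mf * Z * E₃) +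
        Xc * Xc * (μC * Mf * E₂ * E₃)) l := by
    rw [ArithmeticFunction.add_apply, ArithmeticFunction.add_apply, ArithmeticFunction.add_apply, mul_apply,
      mul_apply, mul_apply, mul_apply,
      ← Finset.sum_add_distrib, ← Finset.sum_add_distrib, ← Finset.sum_add_distrib]
    refine Finset.sum_congr rfl fun q hq => ?_
    obtain ⟨hq1, -, -, hq2le⟩ := bounds_of_mem_antidiag hq
    rw [← hXX q.1 hq1, nuOneStar_eq_four_terms c' χ (hq2le.trans hlD), hU, h1]
    ring
  -- the four arithmetic-function identities
  have i1 : Xc * Xc * (μC * Mf * Z * Z) = Z * Xc := by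
    calc Xc * Xc * (μC * Mf * Z * Z) = (Xc * Mf) * (μC * Z) * (Z * Xc) := by ring
      _ = Z * Xc := by rw [hXM, hμZ, one_mul, one_mul]
  have i2 : Xc * Xc * (μC * Mf * E₂ * Z) = Xc * E₂ := by
    calc Xc * Xc * (μC * Mf * E₂ * Z) = (Xc * Mf) * (μC * Z) * (Xc * E₂) := by ring
      _ = Xc * E₂ := by rw [hXM, hμZ, one_mul, one_mul]
  have i3 : Xc * Xc * (μC * Mf * Z * E₃) = Xc * E₃ := by
    calc Xc * Xc * (μC * Mf * Z * E₃) = (Xc * Mf) * (μC * Z) * (Xc * E₃) := by ring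
      _ = Xc * E₃ := by rw [hXM, hμZ, one_mul, one_mul]
  have i4 : Xc * Xc * (μC * Mf * E₂ * E₃) = Xc * μC * E₂ * E₃ := by
    calc Xc * Xc * (μC * Mf * E₂ * E₃) = (Xc * Mf) * (Xc * μC * E₂ * E₃) := by ring
      _ = Xc * μC * E₂ * E₃ := by rw [hXM, one_mul]
  rw [hL, i1, i2, i3, i4, ArithmeticFunction.add_apply, ArithmeticFunction.add_apply,
    ArithmeticFunction.add_apply, nuAF_apply]

end Expansion

end Literature.NumberTheory.LFunctions.Zhang2022.Phi3Eval
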